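import Summits.AtomisticToContinuum.Crystallization.Theorems.FluxTubeKeplerFloorGivesLayered
import Summits.AtomisticToContinuum.Crystallization.Theorems.FluxTubeKeplerFluxCellKeplerSingleScale
import Summits.AtomisticToContinuum.Crystallization.Theorems.ChessboardParticlePlanesPeriodicWindowsIffCrystallization
import Summits.AtomisticToContinuum.Crystallization.Theorems.FluxTubeKeplerKeplerEnergyFloor
import Summits.AtomisticToContinuum.Crystallization.Theorems.FluxTubeKeplerFluxCellKeplerGoodSitesWindows
import Summits.AtomisticToContinuum.Crystallization.Theorems.ThreeConeCertificateSlackRigidityPricedFloorsDefs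

/-!
# Line `OnePointRung` (cell ladder) — skeleton for the forward rung over `FluxTubeKepler.FloorGivesLayered`
(crux dir `FluxCellKepler`, stmt-AtomisticToContinuum-15221; fwd-rung G1 gen 12, seed g1-AtomisticToContinuum-15223)

Stubs (the only `sorry`s): `stub_cleanLimit` (fixed-cell hull extraction), `stub_localChart`
(potential-free first-shell developing step, set form), `stub_driftRegularity` (DRIFT-TOLERANT ε-REGULARITY
OF LOCALLY LAYERED HULL SETS — the bet: screening + block Cauchy–Born coercivity modulo the Barlow box family
+ counting, with Friesecke–James–Müller-type rigidity modulo the family as the alternative route),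
`stub_cleanBallsGiveWindows` (clean hull balls ⇒ good sites; shared verbatim with line `PosTolRung`).  Composition `OnePointRung_of` is sorry-free.

FLOOR (proved, `FluxTubeKeplerFloorGivesLayered.FloorGivesLayered_proof`): for every periodic `P₀`, the energy
floor `N·e(P₀) ≤ E(x)` on Lennard-Jones ground states together with the defect BUDGET
`c(R,η)·#{(R,η)-non-layered sites} ≤ E(x) − N·e(P₀)` at EVERY CELL `(R, η)` of the radius × tolerance dial
forces layered (hence periodic) windows along every ground-state sequence; the proof is cell-by-cell counting.

THE GRADED FAMILY `CellRung 𝓢` (`𝓢 ⊆ ℝ × ℝ` = the set of cells `(R, η)` at which the budget is ASKED;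
ONE move: the budget quantifier `∀ R η` is relativised to `𝓢`; conclusion = the periodic-windows clause):
* `CellRung univ` is the floor (`cellRung_univ`, from the seed + `PeriodicGivenLayered_holds`);
* `CellRung` is MONOTONE in `𝓢` (`cellRung_mono`: fewer cells asked = weaker hypothesis = harder rung);
* gen 1 (`PosTolRung`) is `∃ η₀ > 0, CellRung (univ ×ˢ Ici η₀)`, gen 3 (`FirstShellRung`) is
  `CellRung ({6/5} ×ˢ univ)`; every member is a consequence of the sub-problem (`cellRung_of_crystallization`);
* deciding rung `OnePointRung := ∃ η₀ > 0, CellRung {(6/5, η₀)}` — "a defect budget at ONE cell of the dial,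
  the first coordination shell at one fixed tolerance, already forces crystallization of the ground states".
  It implies the gen-1 and gen-3 rungs (`cellRung_tol_of_point`, `cellRung_firstShell_of_point`) and is implied
  by neither: without the budget at large radii nothing in the hypotheses pins the ORIENTATION of far-apart good
  regions (drift), and without the budget at small tolerances nothing improves `η₀` — both must now come from
  the energy.  The relief for the parent crux is maximal: KEPLER shrinks to ONE finite-precision 13-point
  inequality (`OnePointKepler`, `crystallization_of_onePointKepler`).
-/

noncomputable section

namespace Summit.AtomisticToContinuum.Crystallization.Cruxes.FluxCellKepler.CellLadder

open Filter Topology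
open scoped BigOperators
open Literature.MathematicalPhysics.StatisticalMechanics
open Summit.AtomisticToContinuum.Crystallization.Theorems.FluxCellKeplerSingleScale (LayeredGood layeredGood_mono)
open Summit.AtomisticToContinuum.Crystallization.Theorems.SlackRigidityPricedFloors (layeredSet
  IsAdmissibleLayering LayeredAt)

local notation "E3" => EuclideanSpace ℝ (Fin 3)

/-- FLOOR(P₀): `N · e(P₀) ≤ E(x)` for every Lennard-Jones ground state `x` of every size `N`
(verbatim the first hypothesis of `FluxTubeKepler.FloorGivesLayered`). -/
def Floor (P₀ : PeriodicConfiguration 3) : Prop :=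
  ∀ (N : ℕ) (x : Fin N → E3), IsGroundState lennardJones x →
    (N : ℝ) * P₀.energyPerParticle lennardJones ≤ interactionEnergy lennardJones x

/-- BUDGET(P₀) ON THE CELLS `𝓢`: for every cell `(R, η) ∈ 𝓢` with `R, η > 0` some `c > 0` prices the
`(R, η)`-non-layered sites of every Lennard-Jones ground state against the excess energy over `N · e(P₀)`
(`LayeredGood` is the crux's defect predicate, verbatim; `𝓢 = univ` is the floor's budget at every cell;
the quantifier order `∀ (R,η) ∃ c` of the crux is kept — Disproof §5). -/
def Budget (𝓢 : Set (ℝ × ℝ)) (P₀ : PeriodicConfiguration 3) : Prop :=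
  ∀ R η : ℝ, (R, η) ∈ 𝓢 → 0 < R → 0 < η → ∃ c : ℝ, 0 < c ∧
    ∀ (N : ℕ) (x : Fin N → E3), IsGroundState lennardJones x →
      c * (Nat.card {i : Fin N // ¬ LayeredGood R η x i} : ℝ) ≤
        interactionEnergy lennardJones x - (N : ℝ) * P₀.energyPerParticle lennardJones

/-- Periodic windows at every scale along the sequence `x` (ONE periodic `P`, translations only) —
verbatim the conclusion of `FluxTubeKepler.PeriodicWindows` / `FluxTubeKepler.PeriodicGivenLayered`. -/
def HasPeriodicWindows (x : (N : ℕ) → (Fin N → E3)) : Prop :=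
  ∃ P : PeriodicConfiguration 3, ∀ R ε : ℝ, 0 < ε → ∃ᶠ N in atTop, ∃ t : E3,
    (∀ s ∈ P.points, ‖s‖ ≤ R → ∃ i : Fin N, dist (x N i + t) s ≤ ε) ∧
    (∀ i : Fin N, ‖x N i + t‖ ≤ R → ∃ s ∈ P.points, dist (x N i + t) s ≤ ε)

/-- **The graded family.** `CellRung 𝓢`: FLOOR and the defect budget on the cells `𝓢` force periodic
windows along every Lennard-Jones ground-state sequence. -/
def CellRung (𝓢 : Set (ℝ × ℝ)) : Prop :=
  ∀ P₀ : PeriodicConfiguration 3, Floor P₀ → Budget 𝓢 P₀ →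
    ∀ x : (N : ℕ) → (Fin N → E3), (∀ N, IsGroundState lennardJones (x N)) → HasPeriodicWindows x

/-- The one cell of the dial this line bets on: radius `6/5` (first coordination shell), tolerance `η₀`. -/
def cell (η₀ : ℝ) : Set (ℝ × ℝ) := {((6 : ℝ) / 5, η₀)}

/-- **Deciding rung.** A defect budget at ONE cell `(6/5, η₀)` of the dial, for SOME `η₀ > 0`, suffices. -/
def OnePointRung : Prop := ∃ η₀ : ℝ, 0 < η₀ ∧ CellRung (cell η₀)

/-! ## F3 — the family specialises to the proved floor -/

/-- `CellRung univ` is the floor: the seed theorem followed by the proved `PeriodicGivenLayered`. -/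
theorem cellRung_univ : CellRung Set.univ := fun P₀ hF hB x hx =>
  Theses.FluxTubeKepler.PeriodicGivenLayered_holds x hx
    (Theorems.FluxTubeKeplerFloorGivesLayered.FloorGivesLayered_proof P₀ hF
      (fun R η hR hη => hB R η (Set.mem_univ _) hR hη) x hx)

/-! ## Dial monotonicity (fewer cells asked = harder rung) -/

/-- The budget is antitone in the set of cells. -/
theorem budget_anti {𝓢 𝓣 : Set (ℝ × ℝ)} (h : 𝓢 ⊆ 𝓣) {P₀ : PeriodicConfiguration 3} :
    Budget 𝓣 P₀ → Budget 𝓢 P₀ := fun hB R η hmem hR hη => hB R η (h hmem) hR hη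

/-- `CellRung` is monotone in the set of cells. -/
theorem cellRung_mono {𝓢 𝓣 : Set (ℝ × ℝ)} (h : 𝓢 ⊆ 𝓣) : CellRung 𝓢 → CellRung 𝓣 :=
  fun H P₀ hF hB x hx => H P₀ hF (budget_anti h hB) x hx

/-- Every member gives back the floor member (informational `specialises`). -/
theorem cellRung_univ_of (𝓢 : Set (ℝ × ℝ)) (h : CellRung 𝓢) : CellRung Set.univ :=
  cellRung_mono (Set.subset_univ 𝓢) h

/-- Position in the lattice of rungs: the one-cell rung implies the gen-3 rung (budget on the first shell at
every tolerance, `CellRung ({6/5} ×ˢ univ)`). -/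
theorem cellRung_firstShell_of_point {η₀ : ℝ} (h : CellRung (cell η₀)) :
    CellRung ({(6 : ℝ) / 5} ×ˢ Set.univ) :=
  cellRung_mono (by intro p hp; rw [cell, Set.mem_singleton_iff] at hp; subst hp; simp) h

/-- Position in the lattice of rungs: the one-cell rung implies the gen-1 rung (budget at every radius at
tolerances `≥ η₀`, `CellRung (univ ×ˢ Ici η₀)`). -/
theorem cellRung_tol_of_point {η₀ : ℝ} (h : CellRung (cell η₀)) :
    CellRung (Set.univ ×ˢ Set.Ici η₀) :=
  cellRung_mono (by intro p hp; rw [cell, Set.mem_singleton_iff] at hp; subst hp; simp) h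

/-- The deciding rung gives back the floor. -/
theorem cellRung_univ_of_onePointRung (h : OnePointRung) : CellRung Set.univ := by
  obtain ⟨η₀, _, h⟩ := h
  exact cellRung_univ_of _ h

/-! ## F4 — on-path lemmas: the sub-problem implies every member -/

/-- ON-PATH: `Crystallization → CellRung 𝓢` (landed hull-criterion converse
`periodicWindows_of_crystallization`). -/
theorem cellRung_of_crystallization (𝓢 : Set (ℝ × ℝ)) (h : _root_.Crystallization) : CellRung 𝓢 :=
  fun _ _ _ x hx =>
    Theorems.ChessboardParticlePlanesPeriodicWindowsIffCrystallization.periodicWindows_of_crystallization h x hx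

/-- ON-PATH for the deciding rung (tagged `aesop safe apply` so that the tribunal's fixed `S → C` portfolio
— `simpa using h`, `aesop` — finds it). -/
@[aesop safe apply]
theorem OnePointRung_of_Crystallization (h : _root_.Crystallization) : OnePointRung :=
  ⟨1, one_pos, cellRung_of_crystallization _ h⟩

/-! ## How the rung relieves the parent crux `FluxCellKepler` (sorry-free)

With `CellRung (cell η₀)` in hand the route `FluxTubeKepler` needs its Kepler-type inequality only at the one
cell `(6/5, η₀)`: `OnePointKepler η₀` is the crux `FluxCellKepler` with the KEPLER quantifier `∀ R η` frozen
at `R = 6/5, η = η₀` (DOM unchanged) — one finite-precision inequality on 13-point first-shell patterns — and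
`CellRung (cell η₀) → OnePointKepler η₀ → Crystallization`. -/

/-- The floor-and-budget package on the cells `𝓢`. -/
def KeplerFloorAt (𝓢 : Set (ℝ × ℝ)) : Prop := ∃ P₀ : PeriodicConfiguration 3, Floor P₀ ∧ Budget 𝓢 P₀

theorem crystallization_of_cellRung {𝓢 : Set (ℝ × ℝ)} (h : CellRung 𝓢) (hK : KeplerFloorAt 𝓢) :
    _root_.Crystallization := by
  obtain ⟨P₀, hF, hB⟩ := hK
  exact Theorems.ChessboardParticlePlanesPeriodicWindowsIffCrystallization.crystallization_of_periodicWindows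
    (fun x hx => h P₀ hF hB x hx)

/-- The parent crux gives the package on every set of cells (proved `KeplerEnergyFloor` + minimal distance). -/
theorem keplerFloorAt_of_fluxCellKepler (𝓢 : Set (ℝ × ℝ)) (hK : Theses.FluxTubeKepler.FluxCellKepler) :
    KeplerFloorAt 𝓢 := by
  obtain ⟨P₀, hF, hB⟩ := Theorems.keplerEnergyFloor_proof hK LennardJonesMinimalDistance_holds
  exact ⟨P₀, hF, fun R η _ hR hη => hB R η hR hη⟩

/-- **The one-cell Kepler inequality** (the parent crux `FluxCellKepler` with KEPLER asked only at the cell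
`(R, η) = (6/5, η₀)`; DOM verbatim): a periodic `P₀`, a radius `R₁` and a cell functional `τ` with
(DOM) `Σ_i site₆(x,i) ≤ Σ_i τ(pattern_i)` on injective configurations and (KEPLER at one cell) for every
separation `δ > 0` a constant `c > 0` with `c·#{(6/5,η₀)-non-layered sites} ≤ Σ_i ((1/24)site₁₂ − (1/12)τ) − N·e(P₀)`
on injective `δ`-separated configurations. -/
def OnePointKepler (η₀ : ℝ) : Prop :=
  ∃ (P₀ : PeriodicConfiguration 3) (R₁ : ℝ) (τ : Finset E3 → ℝ),
    (∀ (N : ℕ) (x : Fin N → E3), Function.Injective x →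
      ∑ i, siteEnergy (fun r => (r⁻¹) ^ 6) x i ≤
        ∑ i, τ ((Finset.univ.filter fun j : Fin N => dist (x j) (x i) ≤ R₁).image fun j => x j - x i)) ∧
    (∀ δ : ℝ, 0 < δ → ∃ c : ℝ, 0 < c ∧ ∀ (N : ℕ) (x : Fin N → E3), Function.Injective x →
      (∀ i j, i ≠ j → δ ≤ dist (x i) (x j)) →
      c * (Nat.card {i : Fin N // ¬ LayeredGood (6 / 5) η₀ x i} : ℝ) ≤
        ∑ i, ((1 / 24 : ℝ) * siteEnergy (fun r => (r⁻¹) ^ 12) x i -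
          (1 / 12 : ℝ) * τ ((Finset.univ.filter fun j : Fin N => dist (x j) (x i) ≤ R₁).image fun j => x j - x i)) -
        (N : ℝ) * P₀.energyPerParticle lennardJones)

/-- The parent crux gives the one-cell inequality at every tolerance (restriction of the KEPLER quantifier). -/
theorem onePointKepler_of_fluxCellKepler (η₀ : ℝ) (hη₀ : 0 < η₀)
    (hK : Theses.FluxTubeKepler.FluxCellKepler) : OnePointKepler η₀ := by
  obtain ⟨P₀, R₁, τ, hDOM, hKEP⟩ := hK
  exact ⟨P₀, R₁, τ, hDOM, fun δ hδ => hKEP δ hδ (6 / 5) η₀ (by norm_num) hη₀⟩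

/-- The one-cell inequality gives the floor-and-budget package at the cell (energy identity, DOM with sign
`−1/12`, KEPLER at the Lennard-Jones minimal distance — the argument of the proved `KeplerEnergyFloor`, run at
one cell). [folklore] -/
theorem keplerFloorAt_of_onePointKepler {η₀ : ℝ} (hη₀ : 0 < η₀) (hK : OnePointKepler η₀) :
    KeplerFloorAt (cell η₀) := by
  obtain ⟨P₀, R₁, τ, hDOM, hKEP⟩ := hK
  obtain ⟨δ, hδ, hsep⟩ := LennardJonesMinimalDistance_holds
  obtain ⟨c, hc, h⟩ := hKEP δ hδ
  refine ⟨P₀, ?_, ?_⟩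
  · intro N x hx
    have h1 := Theorems.keplerEnergyFloor_floor_of_dom_kepler' _ _ _ _ _ _ (hDOM N x hx.1)
      (h N x hx.1 (hsep N x hx)) hc (by positivity)
    rw [← Theorems.FluxCellKeplerSketch.interactionEnergy_lennardJones_eq_sum] at h1
    exact h1
  · intro R η hmem hR hη
    rw [cell, Set.mem_singleton_iff, Prod.mk.injEq] at hmem
    obtain ⟨rfl, rfl⟩ := hmem
    refine ⟨c, hc, fun N x hx => ?_⟩
    have h1 := Theorems.keplerEnergyFloor_floor_of_dom_kepler _ _ _ _ _ _ (hDOM N x hx.1)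
      (h N x hx.1 (hsep N x hx))
    rw [← Theorems.FluxCellKeplerSketch.interactionEnergy_lennardJones_eq_sum] at h1
    linarith

/-- **Gap after the rung**: the one-cell rung and the one-cell Kepler inequality decide the sub-problem. -/
theorem crystallization_of_onePointKepler {η₀ : ℝ} (hη₀ : 0 < η₀) (h : CellRung (cell η₀))
    (hK : OnePointKepler η₀) : _root_.Crystallization :=
  crystallization_of_cellRung h (keplerFloorAt_of_onePointKepler hη₀ hK)


/-! ## The line: one cell, through the hull, with drift

Notation.  `InHull x Y`: the set `Y` is a window limit (translations only, frequently in `N`) of the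
sequence `x`.  `LayeredAt ρ ρ η Y p` (`SlackRigidityPricedFloors`): the radius-`ρ` neighbourhood of `p` in
`Y` is two-way `η`-layered with ITS OWN admissible parameters AND ITS OWN rigid motion (so a family of
such local statements over all `p ∈ Y` allows the local frames to DRIFT from point to point).
`CleanBalls Y`: for every `ε > 0`, arbitrarily large balls centred in `Y` all of whose points are
`(2, 2, ε)`-layered. -/

/-- `Y` lies in the hull of the sequence `x` (two-way `ε`-matching on every ball after a translation,
frequently in `N`). -/
def InHull (x : (N : ℕ) → (Fin N → E3)) (Y : Set E3) : Prop :=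
  ∀ R ε : ℝ, 0 < ε → ∃ᶠ N in atTop, ∃ t : E3,
    (∀ p ∈ Y, ‖p‖ ≤ R → ∃ i : Fin N, dist (x N i + t) p ≤ ε) ∧
    (∀ i : Fin N, ‖x N i + t‖ ≤ R → ∃ p ∈ Y, dist (x N i + t) p ≤ ε)

/-- `Y` is uniformly discrete. -/
def Separated (Y : Set E3) : Prop := ∃ δ : ℝ, 0 < δ ∧ ∀ p ∈ Y, ∀ q ∈ Y, p ≠ q → δ ≤ dist p q

/-- Every point of `Y` has a two-way `η`-layered neighbourhood of radius `ρ` (local frames free to drift). -/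
def LocallyLayered (ρ η : ℝ) (Y : Set E3) : Prop := ∀ p ∈ Y, LayeredAt ρ ρ η Y p

/-- `Y` contains, for every tolerance `ε > 0` and every radius, a ball CENTRED AT A POINT OF `Y` all of
whose points are `(2, 2, ε)`-layered in `Y`. -/
def CleanBalls (Y : Set E3) : Prop :=
  ∀ ε : ℝ, 0 < ε → ∀ R' : ℝ, ∃ p₀ ∈ Y, ∀ p ∈ Y, dist p p₀ ≤ R' → LayeredAt 2 2 ε Y p

/-! ### The declared stubs (the only `sorry`s of the file) -/

/-- **Stub 1 — fixed-cell hull extraction (counting + compactness).** Under FLOOR and the budget at the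
one cell `(6/5, η₀)`, along every Lennard-Jones ground-state sequence the `(6/5, η₀)`-non-layered sites have
density `→ 0` (`E(N) − N·e(P₀) = o(N)` by `crysEnergyLimit` and `floor_iff_eq_eStar`); by pigeonhole on the
`7/10`-separated configurations, balls of every radius all of whose sites are `(6/5, η₀)`-good occur for `N`
large; recentring there and passing to a local Hausdorff limit (uniform discreteness from
`LennardJonesMinimalDistance`, compactness of the shell data `(A, a, s, z)` restricted to the first shell)
gives a hull set `Y ∋ 0`, uniformly discrete, EVERY point of which has a two-way `2η₀`-layered first shell
(tolerances `η₀ ≤ 1/100`, where the first-shell / second-shell exclusion annulus `(1.03 + 5η₀, 1.31 − 5η₀)` of the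
box family makes the rim of the matching radius `6/5` pass to the limit). [folklore] -/
theorem stub_cleanLimit :
    ∀ η₀ : ℝ, 0 < η₀ → η₀ ≤ 1 / 100 → ∀ P₀ : PeriodicConfiguration 3, Floor P₀ → Budget (cell η₀) P₀ →
      ∀ x : (N : ℕ) → (Fin N → E3), (∀ N, IsGroundState lennardJones (x N)) →
        ∃ Y : Set E3, InHull x Y ∧ (0 : E3) ∈ Y ∧ Separated Y ∧ LocallyLayered (6 / 5) (2 * η₀) Y := by
  sorry

/-- **Stub 2 — first-shell developing step (potential-free, set form).** For every target tolerance
`ε > 0` there is `η₁ > 0` such that a uniformly discrete set all of whose points have a two-way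
`η`-layered FIRST SHELL (`η ≤ η₁`, radius `6/5`: twelve neighbours `η`-near a relaxed cuboctahedral or
anticuboctahedral shell of some member of the box family, nothing else within `6/5`) is two-way
`ε`-layered at radius `4` about every point (local frames still free to drift from point to point).
Exact case (`η = 0`): a packing all of whose first shells are relaxed (anti)cuboctahedra is locally a
Barlow stacking (overlapping shells glue layer by layer; a non-basal twin or a stacking junction forces a
non-alphabet first shell); the tolerance follows by compactness-and-contradiction as in the landed
`FluxCellKeplerSingleScale.good_of_locallyGood` (there at radius `2`).  Set form of line `FirstShellRung`'s
`stub_firstShellGluing`, cut at radius `4`. [folklore] -/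
theorem stub_localChart :
    ∀ ε : ℝ, 0 < ε → ∃ η₁ : ℝ, 0 < η₁ ∧ ∀ η : ℝ, 0 < η → η ≤ η₁ →
      ∀ Y : Set E3, Separated Y → LocallyLayered (6 / 5) η Y → LocallyLayered 4 ε Y := by
  sorry

/-- **Stub 3 — drift-tolerant ε-regularity of locally layered hull sets (THE BET; load-bearing).** There is
a tolerance `η₂ > 0` such that, whenever some periodic `P₀` satisfies FLOOR (no finite cluster lies below the
bulk energy density `e⋆`), every hull set `Y ∋ 0` of a Lennard-Jones ground-state sequence that is two-way
`η₂`-layered at radius `4` about EVERY point — each point with ITS OWN frame and ITS OWN member of the box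
family, so that the hypothesis tolerates slow rotation / spacing / gap drift across `Y` and never mentions a
global template — contains, for every `ε > 0`, arbitrarily large balls centred in `Y` on which every point
is `(2, 2, ε)`-layered.  Intended proof (energy-derived budget in the near-crystalline regime):
(i) SCREENING — on hull sets of ground states `0 ≤ E(Y ∩ B_R) − e⋆·#(Y ∩ B_R) ≤ C R²` (lower bound = FLOOR
applied to the finite cluster `Y ∩ B_R`; upper bound = local optimality of the hull set + crystal-ball surgery,
`r⁻⁶` tail ⇒ `O(R²)` interaction with the exterior);
(ii) BLOCK CAUCHY–BORN COERCIVITY MODULO THE FAMILY — for locally `η₂`-layered finite clusters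
`E(Z) − e⋆·#Z ≥ κ Σ_{p ∈ Z, interior} ω_p² − C·#∂Z`, `ω_p` = misfit of `B(p, 4) ∩ Z` to the nearest rigid
image of a box-family member: family members have `e ≥ e⋆`; first-order terms vanish modulo family
directions by the site symmetry of Barlow stackings (3-fold axis + vertical mirrors; layer-mean vertical
displacements and in-plane dilations ARE family directions); second order = phonon / elastic stability of the
relaxed polytypes, uniform on the box incl. pre-stress (discrete Cauchy–Born stability à la E–Ming 2007,
Ortner–Theil 2013; the Lennard-Jones constants are a certified computation, cf. the open
`PhononSlackCertificates.NearFieldConvexity`);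
(iii) COUNTING — Markov on (i)+(ii): `#{p ∈ B_R : ω_p > ε} ≤ C R² /(κ ε²) = o(#disjoint R'-balls)`, so some
`R'`-ball is `ε`-clean; inside a clean ball neighbouring radius-4 frames agree to `O(ε)` (shared points), which
is all `(2, 2, ε)`-layeredness asks (drift inside the clean ball is then handled potential-free by Stub 4 /
`good_of_locallyGood`, whose `ε(R, η)` shrinks with the target scale).  Quantitative rigidity modulo the
continuum of wells `SO(3)·𝔽` (Friesecke–James–Müller 2002; discrete: Schmidt 2009, Theil 2006) is the
alternative to (iii) if an `L²`-to-`L^∞` upgrade is wanted.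
May fail if (ii) fails — a bounded, energy-neutral, non-family modulation of a box member (a soft optical
mode of some polytype; buckling of layers under the compressive pre-stress allowed by the gap box
`[39a/50, 17a/20]`) — or if the first-order cancellation modulo the family is incomplete for general Hägg
sequences (sites of symmetry only `C3v` carry a vertical force in an un-relaxed member; absorbed by the free
gaps only layer-wise).  Strictly stronger than line `PosTolRung`'s `stub_hullRegularity` (there `Y` is
globally `η₀`-near ONE template: no drift, one reference member). [conjecture] -/
theorem stub_driftRegularity :
    ∃ η₂ : ℝ, 0 < η₂ ∧ ∀ P₀ : PeriodicConfiguration 3, Floor P₀ →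
      ∀ x : (N : ℕ) → (Fin N → E3), (∀ N, IsGroundState lennardJones (x N)) →
        ∀ Y : Set E3, InHull x Y → (0 : E3) ∈ Y → Separated Y → LocallyLayered 4 η₂ Y → CleanBalls Y := by
  sorry

/-- **Stub 4 — clean hull balls give good sites at every scale (chart gluing + transfer).** If a set
`Y` in the hull of a Lennard-Jones ground-state sequence `x` has clean balls, then at every scale
`(R, η)`, frequently in `N`, some site of `x N` is `(R, η)`-layered-good.  (Set version of the landed
compactness-rigidity `FluxCellKeplerSingleScale.good_of_locallyGood` — all points `(2, η')`-layered on
an `R'`-ball ⇒ the centre is `(R, η/2)`-layered — transported to `x N` through the `InHull` matching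
with tolerance loss `η/2`; uniform discreteness from `LennardJonesMinimalDistance`.)  Shared VERBATIM with
line `PosTolRung` (its Stub 3). [folklore] -/
theorem stub_cleanBallsGiveWindows :
    ∀ x : (N : ℕ) → (Fin N → E3), (∀ N, IsGroundState lennardJones (x N)) →
      ∀ Y : Set E3, InHull x Y → CleanBalls Y →
        ∀ R η : ℝ, 0 < R → 0 < η → ∃ᶠ N in atTop, ∃ i : Fin N, LayeredGood R η (x N) i := by
  sorry

/-! ### The stub statements as named propositions (verbatim) -/

/-- Statement of `stub_cleanLimit` (verbatim). [folklore] -/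
def Sig.stub_cleanLimit : Prop :=
    ∀ η₀ : ℝ, 0 < η₀ → η₀ ≤ 1 / 100 → ∀ P₀ : PeriodicConfiguration 3, Floor P₀ → Budget (cell η₀) P₀ →
      ∀ x : (N : ℕ) → (Fin N → E3), (∀ N, IsGroundState lennardJones (x N)) →
        ∃ Y : Set E3, InHull x Y ∧ (0 : E3) ∈ Y ∧ Separated Y ∧ LocallyLayered (6 / 5) (2 * η₀) Y

/-- Statement of `stub_localChart` (verbatim). [folklore] -/
def Sig.stub_localChart : Prop :=
    ∀ ε : ℝ, 0 < ε → ∃ η₁ : ℝ, 0 < η₁ ∧ ∀ η : ℝ, 0 < η → η ≤ η₁ →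
      ∀ Y : Set E3, Separated Y → LocallyLayered (6 / 5) η Y → LocallyLayered 4 ε Y

/-- Statement of `stub_driftRegularity` (verbatim). [conjecture] -/
def Sig.stub_driftRegularity : Prop :=
    ∃ η₂ : ℝ, 0 < η₂ ∧ ∀ P₀ : PeriodicConfiguration 3, Floor P₀ →
      ∀ x : (N : ℕ) → (Fin N → E3), (∀ N, IsGroundState lennardJones (x N)) →
        ∀ Y : Set E3, InHull x Y → (0 : E3) ∈ Y → Separated Y → LocallyLayered 4 η₂ Y → CleanBalls Y

/-- Statement of `stub_cleanBallsGiveWindows` (verbatim). [folklore] -/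
def Sig.stub_cleanBallsGiveWindows : Prop :=
    ∀ x : (N : ℕ) → (Fin N → E3), (∀ N, IsGroundState lennardJones (x N)) →
      ∀ Y : Set E3, InHull x Y → CleanBalls Y →
        ∀ R η : ℝ, 0 < R → 0 < η → ∃ᶠ N in atTop, ∃ i : Fin N, LayeredGood R η (x N) i

/-! ### The skeleton theorem: the rung BY NAME from the four stub statements (sorry-free) -/

/-- **Assembly.** `stub_cleanLimit → stub_localChart → stub_driftRegularity → stub_cleanBallsGiveWindows →
OnePointRung`: take the `η₂` of Stub 3 and the `η₁` of Stub 2 at target `η₂`; bet on the cell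
`(6/5, η₀)` with `η₀ = min(η₁, 1/100)/2`.  Under FLOOR and the budget there, Stub 1 gives a hull set locally
`2η₀`-layered (`2η₀ ≤ η₁`) at the first shell, Stub 2 upgrades it to locally `η₂`-layered at radius `4`, Stub 3 gives clean balls, Stub 4 good sites
at EVERY scale, hence layered windows (landed `stub_layeredWindowsOfGoodSites`) and periodic windows (proved
`PeriodicGivenLayered`). -/
theorem OnePointRung_of (h₁ : Sig.stub_cleanLimit) (h₂ : Sig.stub_localChart)
    (h₃ : Sig.stub_driftRegularity) (h₄ : Sig.stub_cleanBallsGiveWindows) : OnePointRung := by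
  obtain ⟨η₂, hη₂, hreg⟩ := h₃
  obtain ⟨η₁, hη₁, hchart⟩ := h₂ η₂ hη₂
  have hm₀ : 0 < min η₁ (1 / 100) := lt_min hη₁ (by norm_num)
  have hm₁ : min η₁ (1 / 100) ≤ η₁ := min_le_left _ _
  have hm₂ : min η₁ (1 / 100) ≤ 1 / 100 := min_le_right _ _
  refine ⟨min η₁ (1 / 100) / 2, by positivity, fun P₀ hF hB x hx => ?_⟩
  obtain ⟨Y, hY, h0, hsep, hloc⟩ :=
    h₁ (min η₁ (1 / 100) / 2) (by positivity) (by linarith) P₀ hF hB x hx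
  have hloc4 : LocallyLayered 4 η₂ Y :=
    hchart (2 * (min η₁ (1 / 100) / 2)) (by positivity) (by linarith) Y hsep hloc
  have hgood := h₄ x hx Y hY (hreg P₀ hF x hx Y hY h0 hsep hloc4)
  exact Theses.FluxTubeKepler.PeriodicGivenLayered_holds x hx
    (Theorems.FluxCellKeplerSketch.stub_layeredWindowsOfGoodSites x hgood)

/-- **The closed skeleton instance**: the rung by name from the four declared stubs (the only
`sorry`s of this file enter here). [conjecture] -/
theorem OnePointRung_skeleton : OnePointRung :=
  OnePointRung_of stub_cleanLimit stub_localChart stub_driftRegularity stub_cleanBallsGiveWindows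

end Summit.AtomisticToContinuum.Crystallization.Cruxes.FluxCellKepler.CellLadder

end
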